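import Literature.Computability.AlgebraicComplexity.Bur24UnboundedDegreeClassesField
import Literature.Computability.AlgebraicComplexity.CircuitArithmetization
import Literature.Computability.AlgebraicComplexity.BurgisserBooleanPartsModPCircuits
import Literature.Computability.AlgebraicComplexity.ZModCircuitIntegerCodes
import Literature.Computability.Complexity.CircuitClasses
import HarnessLib

/-!
# `VPnb^{𝔽₂}` is `P/poly`, `VNPnb^{𝔽₂}` is parity of circuits (Bürgisser 2024 survey, Rem. 4.5)

P. Bürgisser, *Completeness classes in algebraic complexity theory* (arXiv:2406.06217, 2024), §4.2
(held text `paper:arxiv-2406.06217`, p0016 L8–L18), after defining the unbounded-degree classes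
`VPnb^𝔽, VNPnb^𝔽` "by allowing circuits using constants in `𝔽` for free" (the tree's
`IsVPnbFamily` / `IsVNPnbFamily`, `Bur24UnboundedDegreeClassesField.lean`):

> If `p = 2`, these classes have been studied in the context of Boolean functions.
> **Remark 4.5.** `VPnb^{𝔽₂}` is the nonuniform version `P/poly` of polynomial time. Moreover,
> `VNPnb^{𝔽₂}` is the nonuniform version `⊕P/poly` of parity polynomial time.

Rendering ("in the context of Boolean functions"): a family `f = (f_n)`, `f_n ∈ 𝔽₂[X_1, …, X_n]`,
DECIDES the language `L ⊆ {0,1}*` if `f_{|x|}(x) = [x ∈ L]` for every `x ∈ {0,1}*`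
(`BoolDecides`, the only definition of record; the tree's `P/poly` is `PPoly` of
`Complexity/CircuitClasses.lean`: languages decided by polynomial-size `B₂`-circuit families).
PROVED:

* **`Bur24_rem_4_5`** — first sentence: `L ∈ P/poly ↔ ∃ f ∈ VPnb^{𝔽₂}` deciding `L`.
* **`Bur24_rem_4_5_parity`** — second sentence in CIRCUIT form: `(∃ f ∈ VNPnb^{𝔽₂}` deciding `L) ↔`
  membership of `x` is the parity of the number of auxiliary vectors `e ∈ {0,1}^{u(|x|)}` accepted
  by a polynomial-size `B₂`-circuit family on `|x| + u(|x|)` inputs, `u` p-bounded — i.e. the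
  nonuniform (circuit) parity class. The ADVICE form `⊕P/poly = (⊕P)/poly` (`polyAdvice ParityP`)
  of this circuit class is the parity analogue of the tree's `PPoly_eq_polyAdvice_P` and is not
  proved or claimed here.

## Structure

* §A `BoolArith` — **direct arithmetization of a `B₂`-circuit** (no degree control; this is what
  separates `VPnb` from `VP`): a Boolean gate with binary truth table `T` (`Complexity.btable`)
  and argument wires `u, v` becomes a block of nine fan-in-two constant-free arithmetic gates
  computing the multilinear extension `Σ_{b₀,b₁} [T(b₀,b₁)] ℓ_{b₀}(u) ℓ_{b₁}(v)` (`ℓ₁(u) = u`,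
  `ℓ₀(u) = 1 - u`); `BoolArith.circuit k Q` has size `9 |Q|` (`circuit_size`), is fan-in two and
  constant-free (`circuit_isFanInTwo`, `circuit_hasSignConstants`) over any commutative ring `k`,
  and on `0/1` points computes `Q` (`BoolArith.eval_gateVal_block`, `BoolArith.eval_bool`, by the
  gate-by-gate semantics `ArithCircuit.gateVal_of_sum/_of_prod` and
  `Complexity.getD_transcript_eq_gateValue`).
* §B `exists_isVPnbFamily_of_mem_PPoly` (`P/poly ⊆ VPnb^{𝔽₂}`) and the integer form
  `exists_isVPnb0Family_of_mem_PPoly` (every `P/poly` language is decided on `0/1` inputs by a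
  `VPnb⁰` family, Def. 4.4).
* §C `exists_circuit_of_zmod2` (one fan-in-two `𝔽₂`-circuit is simulated by a `B₂`-circuit of size
  `(|P| + 1) · gateCost 1 0`: the tree's school-method simulation of arithmetic mod `p ≤ 2^ℓ`,
  `cktSize_testBits_aeval_eval` of `BurgisserBooleanPartsModPCircuits.lean` at `p = 2, ℓ = 1`, on the
  integer lift `ArithCircuit.liftZMod` of `ZModCircuitIntegerCodes.lean`) and
  `mem_PPoly_of_isVPnbFamily` (`VPnb^{𝔽₂} ⊆ P/poly`).
* §D the two statements, with `exists_isVNPnbFamily_of_parityCircuits` /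
  `exists_parityCircuits_of_isVNPnbFamily` (Boolean sums at `0/1` points are parities,
  `ZMod.natCast_eq_one_iff_odd`).

Honest framing: folklore dictionary between `𝔽₂`-arithmetic and Boolean circuits, kernel-checked;
nothing here bears on `VP ≠ VNP` / `VPnb ≠ VNPnb`, which are NOT proved. 0 named facts.

## References

* [Burgisser2024Completeness] P. Bürgisser, arXiv:2406.06217 (2024), §4.2, Rem. 4.5 (p0016
  L12–L18), Def. 4.4 (p0015 L106–L111), p0016 L8–L11.
* [Burgisser2000TCS] P. Bürgisser, *Cook's versus Valiant's hypothesis*, TCS 235 (2000), §5 (A3)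
  p. 86 (Boolean simulation of arithmetic modulo `p`; the tree's `cktSize_testBits_aeval_eval`).
* S. Arora, B. Barak, *Computational Complexity* (2009), Def. 6.1–6.5 (`P/poly`, the tree's
  `PPoly`), Def. 17.15 (`⊕P`).
-/

noncomputable section

open MvPolynomial

namespace Literature.Computability.AlgebraicComplexity

universe u v

/-! ## §A. Direct arithmetization of a `B₂`-circuit (no degree control)

A Boolean circuit over the basis `B₂` (gates of fan-in `≤ 2` with arbitrary truth tables; the
tree's `Literature.Computability.Complexity.Circuit`) is simulated gate by gate by a fan-in-two
constant-free arithmetic circuit over any commutative ring `k`: a gate with binary truth table `T`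
and arguments `u, v` becomes the block computing the multilinear extension
`Σ_{b₀ b₁} T(b₀,b₁) · ℓ_{b₀}(u) ℓ_{b₁}(v)` (`ℓ₁(u) = u`, `ℓ₀(u) = 1 - u`), nine arithmetic gates.
On Boolean inputs the arithmetic circuit computes the circuit's value (`BoolArith.eval_bool`);
its degree may be exponential, its size is `9 |Q|`. -/

namespace BoolArith

open Literature.Computability.Complexity
open CircuitArith (toK)

variable (k : Type u) [CommRing k] {ι : Type v}

/-- The arithmetic operand standing for a Boolean wire: an input variable, or the output gate
`9m + 8` of the block of gate `m`. [cite: Burgisser2024Completeness, Rem. 4.5 (p0016 L12–L18)] -/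
def wireOp : ι ⊕ ℕ → ArithCircuit.Operand k ι
  | .inl i => .var i
  | .inr m => .gate (9 * m + 8)

/-- The operand of argument position `s` of a Boolean gate (`const 0` if the gate has fewer
arguments). [cite: Burgisser2024Completeness, Rem. 4.5 (p0016 L12–L18)] -/
def argOp (g : Complexity.Gate ι) (s : ℕ) : ArithCircuit.Operand k ι :=
  if h : s < g.arity then wireOp k (g.args ⟨s, h⟩) else .const 0

/-- The coefficient `[T(b₀, b₁)] ∈ {0, 1}` of the multilinear extension of the truth table of `g`.
[cite: Burgisser2024Completeness, Rem. 4.5 (p0016 L12–L18)] -/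
abbrev tcoef (g : Complexity.Gate ι) (b0 b1 : Bool) : k := toK k (btable g b0 b1)

/-- Gate `r < 9` of the block of the Boolean gate `g` numbered `m` (base index `9m`):
`1 - u`, `1 - v`, the four products `ℓ_{b₀}(u) ℓ_{b₁}(v)`, and the truth-table combination.
[cite: Burgisser2024Completeness, Rem. 4.5 (p0016 L12–L18)] -/
def blockGate (g : Complexity.Gate ι) (m r : ℕ) : ArithCircuit.Gate k ι :=
  if r = 0 then .sum [(1, .const 1), (-1, argOp k g 0)]
  else if r = 1 then .sum [(1, .const 1), (-1, argOp k g 1)]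
  else if r = 2 then .prod [.gate (9 * m), .gate (9 * m + 1)]
  else if r = 3 then .prod [argOp k g 0, .gate (9 * m + 1)]
  else if r = 4 then .prod [.gate (9 * m), argOp k g 1]
  else if r = 5 then .prod [argOp k g 0, argOp k g 1]
  else if r = 6 then .sum [(tcoef k g false false, .gate (9 * m + 2)), (tcoef k g true false, .gate (9 * m + 3))]
  else if r = 7 then .sum [(tcoef k g false true, .gate (9 * m + 4)), (tcoef k g true true, .gate (9 * m + 5))]
  else .sum [(1, .gate (9 * m + 6)), (1, .gate (9 * m + 7))]

/-- The first `M` blocks of the simulation of the gate list `gs`.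
[cite: Burgisser2024Completeness, Rem. 4.5 (p0016 L12–L18)] -/
def blocks (gs : List (Complexity.Gate ι)) : ℕ → List (ArithCircuit.Gate k ι)
  | 0 => []
  | M + 1 => blocks gs M ++ (List.range 9).map (blockGate k (gs.getD M Circuit.dummyGate) M)

/-- **The arithmetization of a `B₂`-circuit**: all blocks, output = the operand of the output
wire. [cite: Burgisser2024Completeness, Rem. 4.5 (p0016 L12–L18)] -/
def circuit (Q : Circuit ι) : ArithCircuit k ι :=
  ⟨blocks k Q.gates Q.size, wireOp k Q.output⟩

/-- The polynomial of the arithmetization. [cite: Burgisser2024Completeness, Rem. 4.5 (p0016 L12–L18)] -/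
def poly (Q : Circuit ι) : MvPolynomial ι k := (circuit k Q).eval

/-- The blocks have `9M` gates. [cite: Burgisser2024Completeness, Rem. 4.5 (p0016 L12–L18)] -/
theorem length_blocks (gs : List (Complexity.Gate ι)) (M : ℕ) : (blocks k gs M).length = 9 * M := by
  induction M with
  | zero => rfl
  | succ M ih => simp [blocks, ih]; ring

/-- **Size `9 |Q|`.** [cite: Burgisser2024Completeness, Rem. 4.5 (p0016 L12–L18)] -/
theorem circuit_size (Q : Circuit ι) : (circuit k Q).size = 9 * Q.size := length_blocks k _ _

/-- The circuit computes its polynomial (by definition). [cite: Burgisser2024Completeness, Rem. 4.5 (p0016 L12–L18)] -/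
theorem circuit_computes (Q : Circuit ι) : (circuit k Q).Computes (poly k Q) := rfl

/-- Reading gate `9m + r` of the blocks. [cite: Burgisser2024Completeness, Rem. 4.5 (p0016 L12–L18)] -/
theorem blocks_getElem? (gs : List (Complexity.Gate ι)) {M m r : ℕ} (hm : m < M) (hr : r < 9) :
    (blocks k gs M)[9 * m + r]? = some (blockGate k (gs.getD m Circuit.dummyGate) m r) := by
  induction M with
  | zero => exact absurd hm (Nat.not_lt_zero m)
  | succ M ih =>
    rw [blocks]
    rcases Nat.lt_succ_iff_lt_or_eq.1 hm with h | rfl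
    · rw [List.getElem?_append_left (by rw [length_blocks]; omega), ih h]
    · rw [List.getElem?_append_right (by rw [length_blocks]; omega), length_blocks,
        show 9 * m + r - 9 * m = r by omega, List.getElem?_map, List.getElem?_range hr]
      rfl

/-- Every gate of the blocks is a block gate. [cite: Burgisser2024Completeness, Rem. 4.5 (p0016 L12–L18)] -/
theorem mem_blocks (gs : List (Complexity.Gate ι)) (M : ℕ) {G : ArithCircuit.Gate k ι}
    (hG : G ∈ blocks k gs M) : ∃ g m r, r < 9 ∧ G = blockGate k g m r := by
  induction M with
  | zero => simp [blocks] at hG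
  | succ M ih =>
    rw [blocks, List.mem_append] at hG
    rcases hG with h | h
    · exact ih h
    · obtain ⟨r, hr, rfl⟩ := List.mem_map.1 h
      exact ⟨_, _, r, List.mem_range.1 hr, rfl⟩

/-- `[b] ∈ {0, 1}` is a sign constant. [folklore] -/
private theorem isSignConstant_toK (b : Bool) : ArithCircuit.IsSignConstant (toK k b) := by
  cases b
  · exact Or.inl rfl
  · exact Or.inr (Or.inl rfl)

/-- Wire and argument operands are variables, gate references or the constant `0`. [folklore] -/
private theorem argOp_hasSignConstants (g : Complexity.Gate ι) (s : ℕ) :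
    (argOp k g s).HasSignConstants := by
  unfold argOp
  split_ifs with h
  · cases g.args ⟨s, h⟩ <;> exact trivial
  · exact Or.inl rfl

/-- **The arithmetization is fan-in two and constant-free.**
[cite: Burgisser2024Completeness, Rem. 4.5 (p0016 L12–L18)] -/
theorem circuit_isFanInTwo (Q : Circuit ι) : (circuit k Q).IsFanInTwo := by
  intro G hG
  obtain ⟨g, m, r, hr, rfl⟩ := mem_blocks k Q.gates Q.size hG
  unfold blockGate
  split_ifs <;> simp [ArithCircuit.Gate.fanIn, ArithCircuit.Gate.args]

/-- The nine gates of a block, spelled out. [cite: Burgisser2024Completeness, Rem. 4.5 (p0016 L12–L18)] -/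
theorem blockGate_eq (g : Complexity.Gate ι) (m : ℕ) :
    blockGate k g m 0 = .sum [(1, .const 1), (-1, argOp k g 0)] ∧
    blockGate k g m 1 = .sum [(1, .const 1), (-1, argOp k g 1)] ∧
    blockGate k g m 2 = .prod [.gate (9 * m), .gate (9 * m + 1)] ∧
    blockGate k g m 3 = .prod [argOp k g 0, .gate (9 * m + 1)] ∧
    blockGate k g m 4 = .prod [.gate (9 * m), argOp k g 1] ∧
    blockGate k g m 5 = .prod [argOp k g 0, argOp k g 1] ∧
    blockGate k g m 6 = .sum [(tcoef k g false false, .gate (9 * m + 2)),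
      (tcoef k g true false, .gate (9 * m + 3))] ∧
    blockGate k g m 7 = .sum [(tcoef k g false true, .gate (9 * m + 4)),
      (tcoef k g true true, .gate (9 * m + 5))] ∧
    blockGate k g m 8 = .sum [(1, .gate (9 * m + 6)), (1, .gate (9 * m + 7))] := by
  simp [blockGate]

/-- Every block gate is constant-free. [cite: Burgisser2024Completeness, Rem. 4.5 (p0016 L12–L18)] -/
theorem blockGate_hasSignConstants (g : Complexity.Gate ι) (m : ℕ) {r : ℕ} (hr : r < 9) :
    (blockGate k g m r).HasSignConstants := by
  have h1 : ArithCircuit.IsSignConstant (1 : k) := Or.inr (Or.inl rfl)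
  have hn : ArithCircuit.IsSignConstant (-1 : k) := Or.inr (Or.inr (by simp))
  have ha := argOp_hasSignConstants k g
  have ht := isSignConstant_toK k
  obtain ⟨e0, e1, e2, e3, e4, e5, e6, e7, e8⟩ := blockGate_eq k g m
  have hsum : ∀ (c₁ c₂ : k) (u₁ u₂ : ArithCircuit.Operand k ι), ArithCircuit.IsSignConstant c₁ →
      ArithCircuit.IsSignConstant c₂ → u₁.HasSignConstants → u₂.HasSignConstants →
      (ArithCircuit.Gate.sum [(c₁, u₁), (c₂, u₂)]).HasSignConstants := by
    intro c₁ c₂ u₁ u₂ hc₁ hc₂ hu₁ hu₂ a ha'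
    simp only [List.mem_cons, List.not_mem_nil, or_false] at ha'
    rcases ha' with rfl | rfl
    · exact ⟨hc₁, hu₁⟩
    · exact ⟨hc₂, hu₂⟩
  have hprod : ∀ (u₁ u₂ : ArithCircuit.Operand k ι), u₁.HasSignConstants → u₂.HasSignConstants →
      (ArithCircuit.Gate.prod [u₁, u₂]).HasSignConstants := by
    intro u₁ u₂ hu₁ hu₂ u hu
    simp only [List.mem_cons, List.not_mem_nil, or_false] at hu
    rcases hu with rfl | rfl
    · exact hu₁
    · exact hu₂
  have hg : ∀ j : ℕ, (ArithCircuit.Operand.gate j : ArithCircuit.Operand k ι).HasSignConstants :=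
    fun _ => trivial
  have hc1 : (ArithCircuit.Operand.const (1 : k) : ArithCircuit.Operand k ι).HasSignConstants := h1
  interval_cases r
  · rw [e0]; exact hsum _ _ _ _ h1 hn hc1 (ha 0)
  · rw [e1]; exact hsum _ _ _ _ h1 hn hc1 (ha 1)
  · rw [e2]; exact hprod _ _ (hg _) (hg _)
  · rw [e3]; exact hprod _ _ (ha 0) (hg _)
  · rw [e4]; exact hprod _ _ (hg _) (ha 1)
  · rw [e5]; exact hprod _ _ (ha 0) (ha 1)
  · rw [e6]; exact hsum _ _ _ _ (ht _) (ht _) (hg _) (hg _)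
  · rw [e7]; exact hsum _ _ _ _ (ht _) (ht _) (hg _) (hg _)
  · rw [e8]; exact hsum _ _ _ _ h1 h1 (hg _) (hg _)

/-- (constant-free) [cite: Burgisser2024Completeness, Rem. 4.5 (p0016 L12–L18)] -/
theorem circuit_hasSignConstants (Q : Circuit ι) : (circuit k Q).HasSignConstants := by
  refine ⟨fun G hG => ?_, ?_⟩
  · obtain ⟨g, m, r, hr, rfl⟩ := mem_blocks k Q.gates Q.size hG
    exact blockGate_hasSignConstants k g m hr
  · show (wireOp k Q.output).HasSignConstants
    cases Q.output <;> exact trivial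

/-! ### Semantics on Boolean points -/

section Semantics

variable {k}
variable (Q : Circuit ι) (hQ : Q.IsOver B2) (x : ι → Bool)

/-- The Boolean point `[x] ∈ k^ι`. [folklore] -/
private abbrev bpt (x : ι → Bool) : ι → k := fun i => toK k (x i)

/-- The value of a truth table of fan-in `≤ 2` is its binary table at the first two argument
values (absent arguments read `false`). [folklore] -/
private theorem btable_eq_op (g : Complexity.Gate ι) (hg : g.arity ≤ 2) (w : ι ⊕ ℕ → Bool) :
    btable g (if h : 0 < g.arity then w (g.args ⟨0, h⟩) else false)
      (if h : 1 < g.arity then w (g.args ⟨1, h⟩) else false) = g.op fun a => w (g.args a) := by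
  unfold btable
  congr 1
  funext a
  rcases a with ⟨_ | _ | i, ha⟩
  · simp [ha]
  · have h1 : 1 < g.arity := by omega
    simp [h1]
  · omega

/-- The multilinear extension of a binary truth table at a Boolean point is the table value.
[folklore] -/
private theorem table_combination (g : Complexity.Gate ι) (b0 b1 : Bool) :
    tcoef k g false false * ((1 - toK k b0) * (1 - toK k b1)) +
        tcoef k g true false * (toK k b0 * (1 - toK k b1)) +
      (tcoef k g false true * ((1 - toK k b0) * toK k b1) +
        tcoef k g true true * (toK k b0 * toK k b1)) = toK k (btable g b0 b1) := by
  cases b0 <;> cases b1 <;> simp [tcoef]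

/-- **The arithmetization computes the circuit on Boolean points**, block by block: the output
gate `9m + 8` of block `m` evaluates at `[x]` to `[w_m(x)]`, the value of the Boolean gate `m`.
[cite: Burgisser2024Completeness, Rem. 4.5 (p0016 L12–L18)] -/
theorem eval_gateVal_block (hQ : Q.IsOver B2) (x : ι → Bool) :
    ∀ m, m < Q.size → MvPolynomial.eval (bpt x) ((circuit k Q).gateVal (9 * m + 8)) =
      toK k ((transcript x [] Q.gates).getD m false) := by
  set A := circuit k Q with hA
  set W := transcript x [] Q.gates with hW
  set E : MvPolynomial ι k →+* k := MvPolynomial.eval (bpt x) with hE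
  intro m
  induction m using Nat.strong_induction_on with
  | _ m ih =>
    intro hm
    have hmQ : m < Q.gates.length := hm
    set g := Q.gates[m] with hg
    have hgetD : Q.gates.getD m Circuit.dummyGate = g := by
      rw [List.getD_eq_getElem?_getD, List.getElem?_eq_getElem hmQ, Option.getD_some]
    have hgate : ∀ r, r < 9 → A.gates[9 * m + r]? = some (blockGate k g m r) := fun r hr => by
      rw [hA, circuit, blocks_getElem? k Q.gates hm hr, hgetD]
    have harity : g.arity ≤ 2 := hQ g (List.getElem_mem hmQ)
    -- the wires of `g` refer to earlier gates
    have hwf : ∀ (a : Fin g.arity) (m' : ℕ), g.args a = .inr m' → m' < m := fun a m' h =>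
      Q.wf m hmQ a m' h
    -- operands: a wire read at an index `≥ 9m`
    have hwire : ∀ (w : ι ⊕ ℕ), (∀ m', w = .inr m' → m' < m) → ∀ i, 9 * m ≤ i →
        E (A.opVal i (wireOp k w)) = toK k (wireVal x W w) := by
      intro w hw i hi
      cases w with
      | inl j => simp only [wireOp, ArithCircuit.opVal_var, hE, eval_X]; rfl
      | inr m' =>
        have hm' := hw m' rfl
        rw [wireOp, ArithCircuit.opVal_gate, if_pos (by omega), ih m' hm' (by omega)]
        rfl
    have harg : ∀ (s i : ℕ), 9 * m ≤ i → E (A.opVal i (argOp k g s)) =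
        toK k (if h : s < g.arity then wireVal x W (g.args ⟨s, h⟩) else false) := by
      intro s i hi
      unfold argOp
      split_ifs with h
      · exact hwire _ (fun m' hm' => hwf ⟨s, h⟩ m' hm') i hi
      · simp [hE]
    -- the nine gate values
    set a0 := toK k (if h : 0 < g.arity then wireVal x W (g.args ⟨0, h⟩) else false) with ha0
    set a1 := toK k (if h : 1 < g.arity then wireVal x W (g.args ⟨1, h⟩) else false) with ha1
    have hsmul : ∀ (c : k) (q : MvPolynomial ι k), E (c • q) = c * E q := fun c q => by
      rw [smul_eq_C_mul, map_mul, hE, eval_C]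
    have hC1 : E (C 1) = 1 := by rw [hE]; exact eval_C _
    obtain ⟨e0, e1, e2, e3, e4, e5, e6, e7, e8⟩ := blockGate_eq k g m
    have hg0 : A.gates[9 * m]? = some (.sum [(1, .const 1), (-1, argOp k g 0)]) := by
      rw [← e0]; simpa using hgate 0 (by omega)
    have hg1 : A.gates[9 * m + 1]? = some (.sum [(1, .const 1), (-1, argOp k g 1)]) := by
      rw [← e1]; exact hgate 1 (by omega)
    have hg2 : A.gates[9 * m + 2]? = some (.prod [.gate (9 * m), .gate (9 * m + 1)]) := by
      rw [← e2]; exact hgate 2 (by omega)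
    have hg3 : A.gates[9 * m + 3]? = some (.prod [argOp k g 0, .gate (9 * m + 1)]) := by
      rw [← e3]; exact hgate 3 (by omega)
    have hg4 : A.gates[9 * m + 4]? = some (.prod [.gate (9 * m), argOp k g 1]) := by
      rw [← e4]; exact hgate 4 (by omega)
    have hg5 : A.gates[9 * m + 5]? = some (.prod [argOp k g 0, argOp k g 1]) := by
      rw [← e5]; exact hgate 5 (by omega)
    have hg6 : A.gates[9 * m + 6]? = some (.sum [(tcoef k g false false, .gate (9 * m + 2)),
        (tcoef k g true false, .gate (9 * m + 3))]) := by
      rw [← e6]; exact hgate 6 (by omega)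
    have hg7 : A.gates[9 * m + 7]? = some (.sum [(tcoef k g false true, .gate (9 * m + 4)),
        (tcoef k g true true, .gate (9 * m + 5))]) := by
      rw [← e7]; exact hgate 7 (by omega)
    have hg8 : A.gates[9 * m + 8]? = some (.sum [(1, .gate (9 * m + 6)), (1, .gate (9 * m + 7))]) := by
      rw [← e8]; exact hgate 8 (by omega)
    have v0 : E (A.gateVal (9 * m)) = 1 - a0 := by
      rw [A.gateVal_of_sum hg0]
      simp only [List.map_cons, List.map_nil, List.sum_cons, List.sum_nil, map_add, add_zero, hsmul,
        ArithCircuit.opVal_const, hC1, harg 0 (9 * m) le_rfl, ← ha0]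
      ring
    have v1 : E (A.gateVal (9 * m + 1)) = 1 - a1 := by
      rw [A.gateVal_of_sum hg1]
      simp only [List.map_cons, List.map_nil, List.sum_cons, List.sum_nil, map_add, add_zero, hsmul,
        ArithCircuit.opVal_const, hC1, harg 1 (9 * m + 1) (by omega), ← ha1]
      ring
    have hprod2 : ∀ (i : ℕ) (u₁ u₂ : ArithCircuit.Operand k ι),
        A.gates[i]? = some (.prod [u₁, u₂]) →
          E (A.gateVal i) = E (A.opVal i u₁) * E (A.opVal i u₂) := by
      intro i u₁ u₂ h
      rw [A.gateVal_of_prod h]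
      simp only [List.map_cons, List.map_nil, List.prod_cons, List.prod_nil, mul_one, map_mul]
    have hsum2 : ∀ (i : ℕ) (c₁ c₂ : k) (u₁ u₂ : ArithCircuit.Operand k ι),
        A.gates[i]? = some (.sum [(c₁, u₁), (c₂, u₂)]) →
          E (A.gateVal i) = c₁ * E (A.opVal i u₁) + c₂ * E (A.opVal i u₂) := by
      intro i c₁ c₂ u₁ u₂ h
      rw [A.gateVal_of_sum h]
      simp only [List.map_cons, List.map_nil, List.sum_cons, List.sum_nil, add_zero, map_add, hsmul]
    have hgateop : ∀ i j : ℕ, j < i → E (A.opVal i (.gate j)) = E (A.gateVal j) := by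
      intro i j h; rw [ArithCircuit.opVal_gate, if_pos h]
    have v2 : E (A.gateVal (9 * m + 2)) = (1 - a0) * (1 - a1) := by
      rw [hprod2 _ _ _ hg2, hgateop _ _ (by omega), hgateop _ _ (by omega), v0, v1]
    have v3 : E (A.gateVal (9 * m + 3)) = a0 * (1 - a1) := by
      rw [hprod2 _ _ _ hg3, harg 0 (9 * m + 3) (by omega), ← ha0, hgateop _ _ (by omega), v1]
    have v4 : E (A.gateVal (9 * m + 4)) = (1 - a0) * a1 := by
      rw [hprod2 _ _ _ hg4, hgateop _ _ (by omega), v0, harg 1 (9 * m + 4) (by omega), ← ha1]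
    have v5 : E (A.gateVal (9 * m + 5)) = a0 * a1 := by
      rw [hprod2 _ _ _ hg5, harg 0 (9 * m + 5) (by omega), ← ha0, harg 1 (9 * m + 5) (by omega),
        ← ha1]
    have v6 : E (A.gateVal (9 * m + 6)) =
        tcoef k g false false * ((1 - a0) * (1 - a1)) + tcoef k g true false * (a0 * (1 - a1)) := by
      rw [hsum2 _ _ _ _ _ hg6, hgateop _ _ (by omega), hgateop _ _ (by omega), v2, v3]
    have v7 : E (A.gateVal (9 * m + 7)) =
        tcoef k g false true * ((1 - a0) * a1) + tcoef k g true true * (a0 * a1) := by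
      rw [hsum2 _ _ _ _ _ hg7, hgateop _ _ (by omega), hgateop _ _ (by omega), v4, v5]
    rw [hsum2 _ _ _ _ _ hg8, hgateop _ _ (by omega), hgateop _ _ (by omega), v6, v7, one_mul,
      one_mul, ha0, ha1, table_combination, btable_eq_op g harity (wireVal x W),
      ← Complexity.gateValue, hW, ← getD_transcript_eq_gateValue Q x m hmQ]

/-- **`(poly Q)([x]) = [Q(x)]`**: on Boolean points the arithmetization computes the circuit.
[cite: Burgisser2024Completeness, Rem. 4.5 (p0016 L12–L18)] -/
theorem eval_bool (hQ : Q.IsOver B2) (x : ι → Bool) :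
    MvPolynomial.eval (fun i => toK k (x i)) (poly k Q) = toK k (Q.eval x) := by
  rw [poly, ArithCircuit.eval_eq_opVal_output, eval_eq_wireVal, circuit_size]
  show MvPolynomial.eval (bpt x) ((circuit k Q).opVal (9 * Q.size) (wireOp k Q.output)) = _
  cases hout : Q.output with
  | inl j => simp [wireOp, wireVal]
  | inr m =>
    have hm : m < Q.size := Q.wf_output m hout
    rw [wireOp, ArithCircuit.opVal_gate, if_pos (by omega), eval_gateVal_block Q hQ x m hm]
    rfl

end Semantics

end BoolArith

/-! ## §B. Boolean functions of `𝔽₂`-families; `P/poly ⊆ VPnb^{𝔽₂}` -/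

section BooleanParts

open Literature.Computability.Complexity
open CircuitArith (toK)

/-- **The Boolean function of a family over `𝔽₂` decides `L`**: on every `0/1` input the
polynomial `f_{|x|}` takes the value `[x ∈ L] ∈ 𝔽₂` ("`VPnb^{𝔽₂}` … studied in the context of
Boolean functions"). [cite: Burgisser2024Completeness, Rem. 4.5 (p0016 L12–L18)] -/
def BoolDecides (f : ∀ n, MvPolynomial (Fin n) (ZMod 2)) (L : Language Bool) : Prop :=
  ∀ x : List Bool, MvPolynomial.eval (fun i => toK (ZMod 2) (x.get i)) (f x.length) =
    toK (ZMod 2) (L.boolIndicator x)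

/-- A polynomial size bound is p-bounded. [folklore] -/
private theorem isPBounded_polynomial_eval (p : Polynomial ℕ) : IsPBounded fun n => p.eval n :=
  (isPBounded_iff_exists_polynomial_holds _).2 ⟨p, fun _ => le_rfl⟩

/-- **`P/poly ⊆ VPnb^{𝔽₂}`** (half of Rem. 4.5): a language decided by polynomial-size `B₂`-circuits
is decided by a `VPnb^{𝔽₂}` family — the direct arithmetizations of the circuits (`BoolArith`,
size `9 |C_n|`). [cite: Burgisser2024Completeness, Rem. 4.5 (p0016 L15–L16)] -/
theorem exists_isVPnbFamily_of_mem_PPoly {L : Language Bool} (hL : L ∈ PPoly) :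
    ∃ f : ∀ n, MvPolynomial (Fin n) (ZMod 2), IsVPnbFamily f ∧ BoolDecides f L := by
  obtain ⟨p, hp⟩ := Set.mem_iUnion.1 hL
  obtain ⟨C, hC, hdec⟩ := hp
  refine ⟨fun n => BoolArith.poly (ZMod 2) (C n), ⟨IsPBounded.id.mono fun n => by simp,
    fun n => BoolArith.circuit (ZMod 2) (C n), fun n => ⟨BoolArith.circuit_isFanInTwo _ _,
      BoolArith.circuit_computes _ _⟩, ?_⟩, fun x => ?_⟩
  · exact (IsPBounded.mul_holds (IsPBounded.const 9) (isPBounded_polynomial_eval p)).mono fun n => by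
      rw [BoolArith.circuit_size]; exact Nat.mul_le_mul_left 9 (hC n).2
  · rw [BoolArith.eval_bool _ (hC _).1, hdec x]

/-- The same arithmetizations are constant-free INTEGER circuits: every `P/poly` language is
decided, on `0/1` inputs, by a `VPnb⁰` family (value `[x ∈ L] ∈ {0, 1} ⊆ ℤ`).
[cite: Burgisser2024Completeness, Rem. 4.5 and Def. 4.4 (p0016 L15–L16, p0015 L106–L109)] -/
theorem exists_isVPnb0Family_of_mem_PPoly {L : Language Bool} (hL : L ∈ PPoly) :
    ∃ f : ∀ n, MvPolynomial (Fin n) ℤ, IsVPnb0Family f ∧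
      ∀ x : List Bool, MvPolynomial.eval (fun i => toK ℤ (x.get i)) (f x.length) =
        toK ℤ (L.boolIndicator x) := by
  obtain ⟨p, hp⟩ := Set.mem_iUnion.1 hL
  obtain ⟨C, hC, hdec⟩ := hp
  refine ⟨fun n => BoolArith.poly ℤ (C n), ⟨IsPBounded.id.mono fun n => by simp,
    fun n => BoolArith.circuit ℤ (C n), fun n => ⟨BoolArith.circuit_isFanInTwo _ _,
      BoolArith.circuit_hasSignConstants _ _, BoolArith.circuit_computes _ _⟩, ?_⟩, fun x => ?_⟩
  · exact (IsPBounded.mul_holds (IsPBounded.const 9) (isPBounded_polynomial_eval p)).mono fun n => by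
      rw [BoolArith.circuit_size]; exact Nat.mul_le_mul_left 9 (hC n).2
  · rw [BoolArith.eval_bool _ (hC _).1, hdec x]

/-! ## §C. `VPnb^{𝔽₂} ⊆ P/poly`: Boolean simulation of an `𝔽₂`-circuit -/

/-- Over `𝔽₂`, `[a]` recovered from bit `0` of the representative: `[(a.val).testBit 0] = a`.
[folklore] -/
private theorem toK_testBit_val (a : ZMod 2) : toK (ZMod 2) (a.val.testBit 0) = a := by
  fin_cases a <;> rfl

/-- Bit `0` of the representative of `[b] ∈ 𝔽₂` is `b`. [folklore] -/
private theorem testBit_val_toK (b : Bool) : (toK (ZMod 2) b).val.testBit 0 = b := by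
  cases b <;> rfl

/-- **One `𝔽₂`-circuit, simulated**: a fan-in-two arithmetic circuit `P` over `𝔽₂` in the inputs
`ι` is computed on `0/1` inputs by a `B₂`-circuit of size `≤ (|P| + 1) · gateCost 1 0` (the tree's
school-method simulation of arithmetic modulo `p ≤ 2^ℓ`, `BurgisserBooleanPartsModPCircuits.lean`,
at `p = 2`, `ℓ = 1`, applied to the integer lift `ArithCircuit.liftZMod P`).
[cite: Burgisser2024Completeness, Rem. 4.5 (p0016 L15–L16)] -/
theorem exists_circuit_of_zmod2 {ι : Type*} (P : ArithCircuit (ZMod 2) ι) (h2 : P.IsFanInTwo) :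
    ∃ Q : Circuit ι, Q.IsOver B2 ∧ Q.size ≤ (P.size + 1) * gateCost 1 0 ∧
      ∀ y : ι → Bool, toK (ZMod 2) (Q.eval y) =
        MvPolynomial.eval (fun i => toK (ZMod 2) (y i)) P.eval := by
  set z : (ι → Bool) → ι → ZMod 2 := fun y i => toK (ZMod 2) (y i) with hz
  have hzb : ∀ v : ι, CktSize B2 (fun y => testBits 1 (z y v).val) 0 := fun v =>
    (CktSize.proj B2 (fun _ : Fin 1 => v)).congr fun y i => by
      have hi : (i : ℕ) = 0 := by have := i.isLt; omega
      simp only [testBits_apply, hi, hz, testBit_val_toK]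
  have hmain := cktSize_testBits_aeval_eval (p := 2) (ℓ := 1) (by norm_num) z hzb
    (ArithCircuit.liftZMod P) h2.liftZMod
  have haeval : ∀ y, aeval (z y) (ArithCircuit.liftZMod P).eval =
      MvPolynomial.eval (z y) P.eval := fun y => by
    rw [← ArithCircuit.eval_liftZMod P, MvPolynomial.eval_map, MvPolynomial.aeval_def,
      algebraMap_int_eq]
  obtain ⟨Q, hQB, hQs, hQe⟩ := (hmain.outMap fun _ : Unit => (0 : Fin 1)).toCircuit
  refine ⟨Q, hQB, by simpa [ArithCircuit.size_liftZMod] using hQs, fun y => ?_⟩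
  rw [hQe y, testBits_apply, haeval y]
  exact toK_testBit_val _

/-- **`VPnb^{𝔽₂} ⊆ P/poly`** (half of Rem. 4.5): a language decided on `0/1` inputs by a
`VPnb^{𝔽₂}` family is in `P/poly`. [cite: Burgisser2024Completeness, Rem. 4.5 (p0016 L15–L16)] -/
theorem mem_PPoly_of_isVPnbFamily {L : Language Bool} {f : ∀ n, MvPolynomial (Fin n) (ZMod 2)}
    (hf : IsVPnbFamily f) (hL : BoolDecides f L) : L ∈ PPoly := by
  obtain ⟨-, C, hC, hsize⟩ := hf
  obtain ⟨p, hp⟩ := (isPBounded_iff_exists_polynomial_holds _).1 hsize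
  choose Q hQB hQs hQe using fun n => exists_circuit_of_zmod2 (C n) (hC n).1
  refine Set.mem_iUnion.2 ⟨(p + 1) * Polynomial.C (gateCost 1 0), Q, fun n => ⟨hQB n, ?_⟩,
    fun x => ?_⟩
  · refine (hQs n).trans ?_
    simp only [Polynomial.eval_mul, Polynomial.eval_add, Polynomial.eval_one, Polynomial.eval_C]
    exact Nat.mul_le_mul_right _ (Nat.add_le_add_right (hp n) 1)
  · have h := hQe x.length x.get
    rw [(hC _).2, hL x] at h
    have := congrArg (fun a : ZMod 2 => a.val.testBit 0) h
    simpa only [testBit_val_toK] using this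

/-! ## §D. Remark 4.5 -/

/-- **Bürgisser 2024, Rem. 4.5 (first sentence): "`VPnb^{𝔽₂}` is the nonuniform version `P/poly`
of polynomial time"** — in the context of Boolean functions (p0016 L12–L13): a language is in
`P/poly` iff it is decided on `0/1` inputs by a `VPnb^{𝔽₂}` family (`IsVPnbFamily`,
`Bur24UnboundedDegreeClassesField.lean`; the family's `n`-th member in the `n` input variables).
[cite: Burgisser2024Completeness, Rem. 4.5 (p0016 L15–L16)] -/
theorem Bur24_rem_4_5 (L : Language Bool) :
    L ∈ PPoly ↔ ∃ f : ∀ n, MvPolynomial (Fin n) (ZMod 2), IsVPnbFamily f ∧ BoolDecides f L :=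
  ⟨exists_isVPnbFamily_of_mem_PPoly, fun ⟨_, hf, hL⟩ => mem_PPoly_of_isVPnbFamily hf hL⟩

/-! ### Second sentence: `VNPnb^{𝔽₂}` and parity of circuits with auxiliary inputs

"`VNPnb^{𝔽₂}` is the nonuniform version `⊕P/poly` of parity polynomial time." We prove the
CIRCUIT form: a language is decided on `0/1` inputs by a `VNPnb^{𝔽₂}` family (`IsVNPnbFamily`)
iff membership of `x` is the parity of the number of auxiliary vectors `e ∈ {0,1}^{u(|x|)}` accepted
by a polynomial-size `B₂`-circuit family on `|x| + u(|x|)` inputs (`u` p-bounded). (The advice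
form `⊕P/poly = (⊕P)/poly` of this nonuniform class is the parity analogue of
`PPoly_eq_polyAdvice_P` and is not needed here.) -/

/-- The value in `𝔽₂` of a Boolean sum of `0/1` values is the parity of the number of `1`s.
[folklore] -/
private theorem sum_toK_eq_card {α : Type*} [Fintype α] (P : α → Bool) :
    ∑ a, toK (ZMod 2) (P a) = ((Finset.univ.filter fun a => P a = true).card : ZMod 2) := by
  classical
  rw [Finset.card_eq_sum_ones, Nat.cast_sum, Finset.sum_filter]
  refine Finset.sum_congr rfl fun a _ => ?_
  cases P a <;> simp

/-- `[x ∈ L] = (N : 𝔽₂)` iff (`x ∈ L ↔ N` odd). [folklore] -/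
private theorem toK_boolIndicator_eq_natCast_iff (L : Language Bool) (x : List Bool) (N : ℕ) :
    toK (ZMod 2) (L.boolIndicator x) = (N : ZMod 2) ↔ (x ∈ L ↔ Odd N) := by
  by_cases hx : x ∈ L
  · have hb : L.boolIndicator x = true := (L.mem_iff_boolIndicator x).1 hx
    rw [hb, CircuitArith.toK_true, eq_comm, ZMod.natCast_eq_one_iff_odd]
    exact ⟨fun h => ⟨fun _ => h, fun _ => hx⟩, fun h => h.1 hx⟩
  · have hb : L.boolIndicator x = false := (L.notMem_iff_boolIndicator x).1 hx
    rw [hb, CircuitArith.toK_false, eq_comm, ZMod.natCast_eq_zero_iff_even, ← Nat.not_odd_iff_even]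
    exact ⟨fun h => ⟨fun h' => absurd h' hx, fun h' => absurd h' h⟩, fun h h' => hx (h.2 h')⟩

/-- Evaluating a Boolean sum at a `0/1` point: `Σ_e g(x, e)`. [folklore] -/
private theorem eval_boolSum_toK {n u : ℕ} (g : MvPolynomial (Fin n ⊕ Fin u) (ZMod 2))
    (x : Fin n → Bool) :
    MvPolynomial.eval (fun i => toK (ZMod 2) (x i)) (boolSum g) =
      ∑ e : Fin u → Bool, MvPolynomial.eval (fun w => toK (ZMod 2) (Sum.elim x e w)) g := by
  rw [boolSum, map_sum]
  refine Finset.sum_congr rfl fun e _ => ?_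
  change aeval (fun i => toK (ZMod 2) (x i)) (aeval _ g) =
    aeval (fun w => toK (ZMod 2) (Sum.elim x e w)) g
  rw [comp_aeval_apply]
  refine congrArg (fun F => aeval F g) (funext fun w => ?_)
  rcases w with i | j
  · simp
  · simp only [Sum.elim_inr]
    cases e j <;> simp

/-- **Circuits with auxiliary inputs, counted mod 2, give `VNPnb^{𝔽₂}`**: if `x ∈ L` iff the number
of `e ∈ {0,1}^{u(|x|)}` accepted by `C_{|x|}(x, e)` is odd, for a polynomial-size `B₂`-circuit family
`C_n` on `n + u(n)` inputs, then `L` is decided on `0/1` inputs by the `VNPnb^{𝔽₂}` family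
`Σ_e poly(C_n)(X, e)`. [cite: Burgisser2024Completeness, Rem. 4.5 (p0016 L17–L18)] -/
theorem exists_isVNPnbFamily_of_parityCircuits {L : Language Bool} {u : ℕ → ℕ} {p : Polynomial ℕ}
    (C : ∀ n, Circuit (Fin n ⊕ Fin (u n)))
    (hC : ∀ n, (C n).IsOver B2 ∧ (C n).size ≤ p.eval n ∧ u n ≤ p.eval n)
    (hL : ∀ x : List Bool, x ∈ L ↔ Odd (Finset.univ.filter fun e : Fin (u x.length) → Bool =>
      (C x.length).eval (Sum.elim x.get e) = true).card) :
    ∃ f : ∀ n, MvPolynomial (Fin n) (ZMod 2), IsVNPnbFamily f ∧ BoolDecides f L := by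
  have hp := isPBounded_polynomial_eval p
  refine ⟨fun n => boolSum (BoolArith.poly (ZMod 2) (C n)),
    ⟨u, fun n => BoolArith.poly (ZMod 2) (C n), ⟨?_, fun n => BoolArith.circuit (ZMod 2) (C n),
      fun n => ⟨BoolArith.circuit_isFanInTwo _ _, BoolArith.circuit_computes _ _⟩, ?_⟩,
      fun n => rfl⟩, fun x => ?_⟩
  · exact (IsPBounded.add_holds IsPBounded.id hp).mono fun n => by
      simp only [Fintype.card_sum, Fintype.card_fin]; exact Nat.add_le_add_left (hC n).2.2 n
  · exact (IsPBounded.mul_holds (IsPBounded.const 9) hp).mono fun n => by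
      rw [BoolArith.circuit_size]; exact Nat.mul_le_mul_left 9 (hC n).2.1
  · rw [eval_boolSum_toK, (toK_boolIndicator_eq_natCast_iff L x _).2 (hL x), ← sum_toK_eq_card]
    exact Finset.sum_congr rfl fun e _ => BoolArith.eval_bool _ (hC _).1 _

/-- **`VNPnb^{𝔽₂}` families are parities of circuits with auxiliary inputs**: if `L` is decided on
`0/1` inputs by a `VNPnb^{𝔽₂}` family `f_n = Σ_{e ∈ {0,1}^{u(n)}} g_n(X, e)`, then `x ∈ L` iff the
number of `e` accepted by a polynomial-size `B₂`-circuit `C_{|x|}(x, e)` (simulating `g_{|x|}`) is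
odd. [cite: Burgisser2024Completeness, Rem. 4.5 (p0016 L17–L18)] -/
theorem exists_parityCircuits_of_isVNPnbFamily {L : Language Bool}
    {f : ∀ n, MvPolynomial (Fin n) (ZMod 2)} (hf : IsVNPnbFamily f) (hL : BoolDecides f L) :
    ∃ (u : ℕ → ℕ) (p : Polynomial ℕ) (C : ∀ n, Circuit (Fin n ⊕ Fin (u n))),
      (∀ n, (C n).IsOver B2 ∧ (C n).size ≤ p.eval n ∧ u n ≤ p.eval n) ∧
      ∀ x : List Bool, x ∈ L ↔ Odd (Finset.univ.filter fun e : Fin (u x.length) → Bool =>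
        (C x.length).eval (Sum.elim x.get e) = true).card := by
  obtain ⟨u, g, ⟨hcard, P, hP, hsize⟩, hfg⟩ := hf
  obtain ⟨p₁, hp₁⟩ := (isPBounded_iff_exists_polynomial_holds _).1 hsize
  obtain ⟨p₂, hp₂⟩ := (isPBounded_iff_exists_polynomial_holds _).1 hcard
  choose Q hQB hQs hQe using fun n => exists_circuit_of_zmod2 (P n) (hP n).1
  refine ⟨u, (p₁ + 1) * Polynomial.C (gateCost 1 0) + p₂, Q, fun n => ⟨hQB n, ?_, ?_⟩, fun x => ?_⟩
  · refine (hQs n).trans ?_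
    simp only [Polynomial.eval_add, Polynomial.eval_mul, Polynomial.eval_one, Polynomial.eval_C]
    exact le_add_right (Nat.mul_le_mul_right _ (Nat.add_le_add_right (hp₁ n) 1))
  · have h := hp₂ n
    simp only [Fintype.card_sum, Fintype.card_fin] at h
    simp only [Polynomial.eval_add, Polynomial.eval_mul, Polynomial.eval_one, Polynomial.eval_C]
    exact le_add_left ((Nat.le_add_left _ _).trans h)
  · rw [← toK_boolIndicator_eq_natCast_iff, ← hL x, hfg, eval_boolSum_toK, ← sum_toK_eq_card]
    exact Finset.sum_congr rfl fun e _ => by rw [hQe, (hP _).2]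

/-- **Bürgisser 2024, Rem. 4.5 (second sentence), circuit form: "`VNPnb^{𝔽₂}` is the nonuniform
version `⊕P/poly` of parity polynomial time"** — a language is decided on `0/1` inputs by a
`VNPnb^{𝔽₂}` family iff membership is the parity of the number of auxiliary vectors accepted by a
polynomial-size `B₂`-circuit family with p-boundedly many auxiliary inputs.
[cite: Burgisser2024Completeness, Rem. 4.5 (p0016 L17–L18)] -/
theorem Bur24_rem_4_5_parity (L : Language Bool) :
    (∃ f : ∀ n, MvPolynomial (Fin n) (ZMod 2), IsVNPnbFamily f ∧ BoolDecides f L) ↔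
      ∃ (u : ℕ → ℕ) (p : Polynomial ℕ) (C : ∀ n, Circuit (Fin n ⊕ Fin (u n))),
        (∀ n, (C n).IsOver B2 ∧ (C n).size ≤ p.eval n ∧ u n ≤ p.eval n) ∧
        ∀ x : List Bool, x ∈ L ↔ Odd (Finset.univ.filter fun e : Fin (u x.length) → Bool =>
          (C x.length).eval (Sum.elim x.get e) = true).card :=
  ⟨fun ⟨_, hf, hL⟩ => exists_parityCircuits_of_isVNPnbFamily hf hL,
    fun ⟨_, _, C, hC, hL⟩ => exists_isVNPnbFamily_of_parityCircuits C hC hL⟩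

end BooleanParts

end Literature.Computability.AlgebraicComplexity

end
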